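import Mathlib
import Literature.RingTheory.MvPolynomial.PlaneCurvesWeakBezout

/-!
# Plane curves: the dilation structure lemma (transporter argument at rank 2)

* `coeff_aeval_smul_X`, `isHomogeneous_of_aeval_smul_X`, `eval_smul_of_isHomogeneous` — a
  polynomial carried onto a multiple of itself by a non-torsion dilation `z ↦ λz` is homogeneous.
* `structure_lemma` — an irreducible plane curve `G` over a field of characteristic `0`
  containing `a + c·D` and `a' + λc·D` for an infinite set of lattice points `D ⊆ ℤ²`, `c ≠ 0`
  and a non-torsion `λ`, is a LINE WITH RATIONAL DIRECTION `G = u·(q₀X₀ + q₁X₁ − κ)`,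
  `q ∈ ℤ² ∖ 0` (weak Bezout makes the two dilated copies of `G` proportional, so `V(G)` has a
  dilation symmetry of ratio `λ` about a centre `c₀`; comparing homogeneous parts about `c₀`,
  `G` is a cone at `c₀`; an irreducible cone through two lattice translates is the line through
  them).

## References

* [Fulton1969] W. Fulton, *Algebraic Curves*, Benjamin 1969, Ch. 1 §6 (plane curves without common
  component meet in finitely many points; elimination via Gauss's lemma).
* [Lang2002] S. Lang, *Algebra*, 3rd ed., Springer GTM 211, Ch. IV §2 (Gauss's lemma).
-/

noncomputable section

open scoped Polynomial
open Polynomial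

namespace Literature.RingTheory.MvPolynomial.PlaneCurves

variable {k : Type*} [Field k]

/-- Coefficients of a dilated polynomial: `coeff d (P(λ X)) = λ^{|d|} coeff d P`. [folklore] -/
theorem coeff_aeval_smul_X (P : MvPolynomial (Fin 2) k) (l : k) (d : Fin 2 →₀ ℕ) :
    MvPolynomial.coeff d (MvPolynomial.aeval (fun i => MvPolynomial.C l * MvPolynomial.X i) P) =
      l ^ d.degree * MvPolynomial.coeff d P := by
  induction P using MvPolynomial.induction_on' with
  | monomial s a =>
    rw [MvPolynomial.aeval_monomial, Finsupp.prod_pow, Finsupp.degree_eq_sum]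
    simp only [mul_pow, Finset.prod_mul_distrib, ← map_pow, ← map_prod, Finset.prod_pow_eq_pow_sum]
    rw [show (∏ i : Fin 2, MvPolynomial.X i ^ s i : MvPolynomial (Fin 2) k) = MvPolynomial.monomial s 1 by
      rw [MvPolynomial.monomial_eq, MvPolynomial.C_1, one_mul, Finsupp.prod_pow]]
    rw [MvPolynomial.algebraMap_eq, ← mul_assoc, ← MvPolynomial.C_mul, MvPolynomial.C_mul_monomial,
      mul_one, MvPolynomial.coeff_monomial, MvPolynomial.coeff_monomial]
    split_ifs with h
    · subst h; ring
    · simp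
  | add p q hp hq =>
    rw [map_add, MvPolynomial.coeff_add, MvPolynomial.coeff_add, hp, hq, mul_add]

/-- A polynomial rescaled by a non-torsion factor onto a multiple of itself is homogeneous:
`P(λz) = θ P(z)` with `n ↦ λⁿ` injective forces all monomials of `P` to have the same degree.
[folklore] -/
theorem isHomogeneous_of_aeval_smul_X {P : MvPolynomial (Fin 2) k} {l θ : k}
    (hl : ∀ m n : ℕ, l ^ m = l ^ n → m = n)
    (hP : MvPolynomial.aeval (fun i => MvPolynomial.C l * MvPolynomial.X i) P = MvPolynomial.C θ * P) :
    P.IsHomogeneous P.totalDegree := by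
  by_cases hP0 : P = 0
  · rw [hP0]; exact MvPolynomial.isHomogeneous_zero _ _ _
  -- all monomials in the support have `λ^{deg} = θ`
  have hdeg : ∀ d ∈ P.support, l ^ d.degree = θ := by
    intro d hd
    have := congrArg (MvPolynomial.coeff d) hP
    rw [coeff_aeval_smul_X, MvPolynomial.coeff_C_mul] at this
    exact mul_right_cancel₀ (MvPolynomial.mem_support_iff.mp hd) this
  -- a monomial of top degree exists
  obtain ⟨d₀, hd₀, hd₀deg⟩ : ∃ d₀ ∈ P.support, d₀.degree = P.totalDegree := by
    obtain ⟨d₀, hd₀, h⟩ := Finset.exists_max_image P.support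
      (fun d => d.sum fun _ e => e) (MvPolynomial.support_nonempty.mpr hP0)
    refine ⟨d₀, hd₀, le_antisymm (MvPolynomial.le_totalDegree hd₀) ?_⟩
    rw [MvPolynomial.totalDegree]
    exact Finset.sup_le fun d hd => by
      have := h d hd
      rw [Finsupp.degree_apply]
      exact this
  intro d hd
  change Finsupp.weight (fun _ => 1) d = P.totalDegree
  rw [← Finsupp.degree_eq_weight_one, ← hd₀deg]
  apply hl
  rw [hdeg d (MvPolynomial.mem_support_iff.mpr hd), hdeg d₀ hd₀]

/-- A homogeneous polynomial of degree `n` rescales by `λⁿ`. [folklore] -/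
theorem aeval_smul_X_of_isHomogeneous {P : MvPolynomial (Fin 2) k} {n : ℕ}
    (hP : P.IsHomogeneous n) (l : k) :
    MvPolynomial.aeval (fun i => MvPolynomial.C l * MvPolynomial.X i) P = MvPolynomial.C (l ^ n) * P := by
  ext d
  rw [coeff_aeval_smul_X, MvPolynomial.coeff_C_mul]
  by_cases hd : MvPolynomial.coeff d P = 0
  · rw [hd, mul_zero, mul_zero]
  · have := hP hd
    change Finsupp.weight (fun _ => 1) d = n at this
    rw [← Finsupp.degree_eq_weight_one] at this
    rw [this]

/-- A homogeneous polynomial vanishing at `w` vanishes on the line `k·w`. [folklore] -/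
theorem eval_smul_of_isHomogeneous {P : MvPolynomial (Fin 2) k} {n : ℕ}
    (hP : P.IsHomogeneous n) (w : Fin 2 → k) (t : k) :
    MvPolynomial.eval (t • w) P = t ^ n * MvPolynomial.eval w P := by
  have h := congrArg (MvPolynomial.eval w) (aeval_smul_X_of_isHomogeneous hP t)
  rw [MvPolynomial.eval_mul, MvPolynomial.eval_C] at h
  rw [← h]
  have e : (MvPolynomial.eval w).comp
      (MvPolynomial.aeval (fun i => MvPolynomial.C t * MvPolynomial.X i)).toRingHom =
      MvPolynomial.eval (t • w) :=
    MvPolynomial.ringHom_ext (fun r => by simp) (fun i => by simp)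
  exact (RingHom.congr_fun e P).symm


/-! ### The structure lemma: a curve with a non-torsion dilation symmetry onto itself -/

section Geo

variable [Infinite k] [CharZero k]

/-- Dilation-translation `z ↦ b + c z` as an algebra automorphism of `k[X₀, X₁]`. [folklore] -/
noncomputable def dilate (b : Fin 2 → k) (c : k) (hc : c ≠ 0) :
    MvPolynomial (Fin 2) k ≃ₐ[k] MvPolynomial (Fin 2) k :=
  affEquiv (fun i => MvPolynomial.C (b i) + MvPolynomial.C c * MvPolynomial.X i)
    (fun i => MvPolynomial.C c⁻¹ * (MvPolynomial.X i - MvPolynomial.C (b i)))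
    (by
      intro p i
      fin_cases i
      · simp; field_simp; ring
      · simp; field_simp; ring)
    (by
      intro p i
      fin_cases i
      · simp; field_simp
      · simp; field_simp)

omit [CharZero k] in
/-- Evaluating a dilated-translated polynomial. [folklore] -/
theorem eval_dilate (b : Fin 2 → k) (c : k) (hc : c ≠ 0) (P : MvPolynomial (Fin 2) k)
    (p : Fin 2 → k) :
    MvPolynomial.eval p (dilate b c hc P) = MvPolynomial.eval (fun i => b i + c * p i) P := by
  rw [dilate, affEquiv_apply, eval_aeval_eq]
  have e : (fun i => MvPolynomial.eval p (MvPolynomial.C (b i) + MvPolynomial.C c * MvPolynomial.X i)) =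
      fun i => b i + c * p i := by
    funext i; simp
  rw [e]

omit [Infinite k] in
/-- The integer lattice embeds in `k²`. [folklore] -/
theorem intCast_injective2 : Function.Injective (fun κ : Fin 2 → ℤ => fun i => (κ i : k)) := by
  intro κ κ' h
  funext i
  have := congr_fun h i
  simp only at this
  exact_mod_cast this

/-- STRUCTURE LEMMA (the transporter argument at rank 2). Let `G` be an irreducible plane curve
over a field `k` of characteristic `0`, `D ⊂ ℤ²` infinite, and suppose `a + c·D ⊆ V(G)` and
`a' + λc·D ⊆ V(G)` for some `c ≠ 0` and a non-torsion `λ` (`n ↦ λⁿ` injective). Then `G` is a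
LINE with RATIONAL direction: `G = u · (q₀ X₀ + q₁ X₁ − κ)`, `q ∈ ℤ² ∖ 0`. (Bezout: the two
dilated copies of `G` through `D` are proportional, so `V(G)` is invariant under a dilation of
ratio `λ` about a centre `c₀`; comparing homogeneous parts about `c₀`, `G` is a cone at `c₀`,
and an irreducible cone containing two lattice translates is the line through them.) [folklore] -/
theorem structure_lemma {G : MvPolynomial (Fin 2) k} (hG : Irreducible G)
    {a a' : Fin 2 → k} {c l : k} (hc : c ≠ 0) (hl : ∀ m n : ℕ, l ^ m = l ^ n → m = n)
    {D : Set (Fin 2 → ℤ)} (hD : D.Infinite)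
    (h1 : ∀ κ ∈ D, MvPolynomial.eval (fun i => a i + c * (κ i : k)) G = 0)
    (h2 : ∀ κ ∈ D, MvPolynomial.eval (fun i => a' i + l * c * (κ i : k)) G = 0) :
    ∃ (q : Fin 2 → ℤ) (κ u : k), q ≠ 0 ∧ u ≠ 0 ∧
      G = MvPolynomial.C u * (MvPolynomial.C (q 0 : k) * MvPolynomial.X 0 +
        MvPolynomial.C (q 1 : k) * MvPolynomial.X 1 - MvPolynomial.C κ) := by
  have hl0 : l ≠ 0 := by
    intro h; have := hl 1 2 (by rw [h]; ring); omega
  have hl1 : l ≠ 1 := by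
    intro h; have := hl 0 1 (by rw [h]; ring); omega
  have hlc : l * c ≠ 0 := mul_ne_zero hl0 hc
  -- the two dilated copies of `G` through `D`
  set G₁ := dilate a c hc G with hG₁
  set G₂ := dilate a' (l * c) hlc G with hG₂
  have hG₁irr : Irreducible G₁ := (MulEquiv.irreducible_iff (dilate a c hc).toMulEquiv).mpr hG
  have hG₂irr : Irreducible G₂ :=
    (MulEquiv.irreducible_iff (dilate a' (l * c) hlc).toMulEquiv).mpr hG
  have hzeros : ∀ κ ∈ D, MvPolynomial.eval (fun i => (κ i : k)) G₁ = 0 ∧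
      MvPolynomial.eval (fun i => (κ i : k)) G₂ = 0 := by
    intro κ hκ
    rw [hG₁, hG₂, eval_dilate, eval_dilate]
    exact ⟨h1 κ hκ, h2 κ hκ⟩
  have hinf12 : {p : Fin 2 → k | MvPolynomial.eval p G₁ = 0 ∧ MvPolynomial.eval p G₂ = 0}.Infinite := by
    refine Set.infinite_of_injOn_mapsTo (f := fun κ : Fin 2 → ℤ => fun i => (κ i : k))
      (intCast_injective2.injOn) (fun κ hκ => hzeros κ hκ) hD
  have hinf21 : {p : Fin 2 → k | MvPolynomial.eval p G₂ = 0 ∧ MvPolynomial.eval p G₁ = 0}.Infinite := by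
    convert hinf12 using 2
    ext p
    exact and_comm
  -- Bezout both ways: the copies are proportional
  have h12 : G₁ ∣ G₂ := dvd_of_infinite_commonZeros hG₁irr hinf12
  have h21 : G₂ ∣ G₁ := dvd_of_infinite_commonZeros hG₂irr hinf21
  obtain ⟨uu, huu⟩ := associated_of_dvd_dvd h12 h21
  obtain ⟨θ, hθu, hθ⟩ := MvPolynomial.isUnit_iff_eq_C_of_isReduced.mp uu.isUnit
  have hθ0 : θ ≠ 0 := hθu.ne_zero
  -- pointwise: `G(λ z + μ) = θ G(z)`
  set μ : Fin 2 → k := fun i => a' i - l * a i with hμ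
  have hscale : ∀ z : Fin 2 → k,
      MvPolynomial.eval (fun i => l * z i + μ i) G = θ * MvPolynomial.eval z G := by
    intro z
    have h := congrArg (MvPolynomial.eval fun i => (z i - a i) / c) huu
    rw [MvPolynomial.eval_mul, hθ, MvPolynomial.eval_C, hG₁, hG₂, eval_dilate, eval_dilate] at h
    have e1 : (fun i => a i + c * ((z i - a i) / c)) = z := by
      funext i; field_simp; ring
    have e2 : (fun i => a' i + l * c * ((z i - a i) / c)) = fun i => l * z i + μ i := by
      funext i; rw [hμ]; field_simp; ring
    rw [e1, e2] at h
    rw [← h, mul_comm]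
  -- recentre at the fixed point `c₀`
  have h1l : (1 - l) ≠ 0 := sub_ne_zero.mpr (Ne.symm hl1)
  set c₀ : Fin 2 → k := fun i => μ i / (1 - l) with hc₀
  set Gt := dilate c₀ 1 one_ne_zero G with hGt
  have hGtirr : Irreducible Gt := (MulEquiv.irreducible_iff (dilate c₀ 1 one_ne_zero).toMulEquiv).mpr hG
  have hGt_eval : ∀ w : Fin 2 → k, MvPolynomial.eval w Gt = MvPolynomial.eval (fun i => c₀ i + w i) G := by
    intro w; rw [hGt, eval_dilate]; simp
  have hGt_scale : MvPolynomial.aeval (fun i => MvPolynomial.C l * MvPolynomial.X i) Gt =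
      MvPolynomial.C θ * Gt := by
    apply MvPolynomial.funext
    intro w
    rw [eval_aeval_eq, MvPolynomial.eval_mul, MvPolynomial.eval_C]
    have e : (fun i => MvPolynomial.eval w (MvPolynomial.C l * MvPolynomial.X i)) = fun i => l * w i := by
      funext i; simp
    rw [e, hGt_eval, hGt_eval]
    have e2 : (fun i => c₀ i + l * w i) = fun i => l * (c₀ i + w i) + μ i := by
      funext i; rw [hc₀]; field_simp; ring
    rw [e2, hscale]
  -- `Gt` is homogeneous of positive degree
  have hhom := isHomogeneous_of_aeval_smul_X hl hGt_scale
  set d := Gt.totalDegree with hd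
  -- two lattice points, the first off the centre
  obtain ⟨κ₁, hκ₁, κ₂, hκ₂, hne, hw₁⟩ : ∃ κ₁ ∈ D, ∃ κ₂ ∈ D, κ₁ ≠ κ₂ ∧
      (fun i => a i + c * (κ₁ i : k) - c₀ i) ≠ 0 := by
    obtain ⟨κ₂, hκ₂⟩ := hD.nonempty
    obtain ⟨κ₁, hκ₁, hne'⟩ := hD.exists_notMem_finset {κ₂}
    have hne : κ₁ ≠ κ₂ := by simpa using hne'
    by_cases hw : (fun i => a i + c * (κ₁ i : k) - c₀ i) = 0
    · refine ⟨κ₂, hκ₂, κ₁, hκ₁, hne.symm, ?_⟩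
      intro hw'
      apply hne
      apply intCast_injective2 (k := k)
      funext i
      have h1 := congr_fun hw i
      have h2 := congr_fun hw' i
      simp only [Pi.zero_apply] at h1 h2
      have : c * (κ₁ i : k) = c * (κ₂ i : k) := by linear_combination h1 - h2
      exact mul_left_cancel₀ hc this
    · exact ⟨κ₁, hκ₁, κ₂, hκ₂, hne, hw⟩
  set w₁ : Fin 2 → k := fun i => a i + c * (κ₁ i : k) - c₀ i with hw₁def
  set w₂ : Fin 2 → k := fun i => a i + c * (κ₂ i : k) - c₀ i with hw₂def
  have hGtw : ∀ κ ∈ D, MvPolynomial.eval (fun i => a i + c * (κ i : k) - c₀ i) Gt = 0 := by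
    intro κ hκ
    rw [hGt_eval]
    have e : (fun i => c₀ i + (a i + c * (κ i : k) - c₀ i)) = fun i => a i + c * (κ i : k) := by
      funext i; ring
    rw [e]
    exact h1 κ hκ
  have hGtw₁ : MvPolynomial.eval w₁ Gt = 0 := hGtw κ₁ hκ₁
  have hGtw₂ : MvPolynomial.eval w₂ Gt = 0 := hGtw κ₂ hκ₂
  -- `Gt` vanishes on the line through `0` and `w₁`, so that line divides it
  have hvan : ∀ p : Fin 2 → k, w₁ 1 * p 0 - w₁ 0 * p 1 = 0 → MvPolynomial.eval p Gt = 0 := by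
    intro p hp
    obtain ⟨t, rfl⟩ : ∃ t : k, p = t • w₁ := by
      by_cases h0 : w₁ 0 = 0
      · have h1 : w₁ 1 ≠ 0 := by
          intro h1; apply hw₁; funext i; fin_cases i
          · exact h0
          · exact h1
        refine ⟨p 1 / w₁ 1, ?_⟩
        funext i
        fin_cases i
        · rw [h0, zero_mul, sub_zero] at hp
          have : p 0 = 0 := (mul_eq_zero.mp hp).resolve_left h1
          simp [this, h0]
        · simp; field_simp
      · refine ⟨p 0 / w₁ 0, ?_⟩
        funext i
        fin_cases i
        · simp; field_simp
        · simp; field_simp; linear_combination -hp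
    rw [eval_smul_of_isHomogeneous hhom, hGtw₁, mul_zero]
  obtain ⟨R, hR⟩ := linear_dvd_of_vanish hw₁ 0 hvan
  -- `Gt` irreducible: the cofactor is a unit
  set L₁ : MvPolynomial (Fin 2) k :=
    MvPolynomial.C (w₁ 1) * MvPolynomial.X 0 - MvPolynomial.C (w₁ 0) * MvPolynomial.X 1 -
    MvPolynomial.C (0 : k) with hL₁
  have hL₁nu : ¬ IsUnit L₁ := by
    intro hu
    obtain ⟨r, hr, hLr⟩ := MvPolynomial.isUnit_iff_eq_C_of_isReduced.mp hu
    have := congrArg (MvPolynomial.eval (0 : Fin 2 → k)) hLr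
    rw [hL₁] at this
    simp at this
    exact hr.ne_zero this.symm
  rcases hGtirr.isUnit_or_isUnit hR with hu | hu
  · exact absurd hu hL₁nu
  obtain ⟨r, hr, hRr⟩ := MvPolynomial.isUnit_iff_eq_C_of_isReduced.mp hu
  have hr0 : r ≠ 0 := hr.ne_zero
  -- the line passes through `w₂` as well: rational direction
  have hL₁w₂ : w₁ 1 * w₂ 0 - w₁ 0 * w₂ 1 = 0 := by
    have := hGtw₂
    rw [hR, hRr, MvPolynomial.eval_mul, MvPolynomial.eval_C] at this
    simp [hL₁] at this
    rcases this with h | h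
    · linear_combination h
    · exact absurd h hr0
  set m : Fin 2 → ℤ := fun i => κ₁ i - κ₂ i with hm
  have hm0 : m ≠ 0 := by
    intro h; apply hne; funext i; have := congr_fun h i; simp [hm] at this; linarith
  have hwm : w₁ 1 * (m 0 : k) = w₁ 0 * (m 1 : k) := by
    have e0 : w₁ 0 - w₂ 0 = c * (m 0 : k) := by simp [hw₁def, hw₂def, hm]; ring
    have e1 : w₁ 1 - w₂ 1 = c * (m 1 : k) := by simp [hw₁def, hw₂def, hm]; ring
    have h3 : w₁ 1 * (w₁ 0 - w₂ 0) - w₁ 0 * (w₁ 1 - w₂ 1) = 0 := by linear_combination (-1 : k) * hL₁w₂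
    rw [e0, e1] at h3
    have h4 : c * (w₁ 1 * (m 0 : k) - w₁ 0 * (m 1 : k)) = 0 := by linear_combination h3
    have h5 := (mul_eq_zero.mp h4).resolve_left hc
    linear_combination h5
  obtain ⟨γ, hγ0, hγ1, hγ0'⟩ : ∃ γ : k, γ ≠ 0 ∧ w₁ 1 = γ * (m 1 : k) ∧ w₁ 0 = γ * (m 0 : k) := by
    by_cases hm00 : m 0 = 0
    · have hm1 : m 1 ≠ 0 := by
        intro h; apply hm0; funext i; fin_cases i
        · exact hm00
        · exact h
      have hm1k : (m 1 : k) ≠ 0 := by exact_mod_cast hm1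
      have hw10 : w₁ 0 = 0 := by
        rw [hm00, Int.cast_zero, mul_zero] at hwm
        exact (mul_eq_zero.mp hwm.symm).resolve_right hm1k
      have hw11 : w₁ 1 ≠ 0 := by
        intro h; apply hw₁; funext i; fin_cases i
        · exact hw10
        · exact h
      refine ⟨w₁ 1 / (m 1 : k), div_ne_zero hw11 hm1k, ?_, ?_⟩
      · field_simp
      · rw [hw10, hm00, Int.cast_zero, mul_zero]
    · have hm0k : (m 0 : k) ≠ 0 := by exact_mod_cast hm00
      have hw10 : w₁ 0 ≠ 0 := by
        intro h
        rw [h, zero_mul] at hwm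
        have hw11 : w₁ 1 = 0 := (mul_eq_zero.mp hwm).resolve_right hm0k
        apply hw₁; funext i; fin_cases i
        · exact h
        · exact hw11
      refine ⟨w₁ 0 / (m 0 : k), div_ne_zero hw10 hm0k, ?_, ?_⟩
      · field_simp; linear_combination hwm
      · field_simp
  -- unwind: `G(z) = Gt(z - c₀) = r γ (m₁ (z₀ - c₀₀) - m₀ (z₁ - c₀₁))`
  refine ⟨![m 1, -m 0], (m 1 : k) * c₀ 0 - (m 0 : k) * c₀ 1, r * γ, ?_, mul_ne_zero hr0 hγ0, ?_⟩
  · intro h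
    apply hm0
    have h0 : m 1 = 0 := by simpa using congr_fun h 0
    have h1 : m 0 = 0 := by simpa using congr_fun h 1
    funext i; fin_cases i
    · exact h1
    · exact h0
  apply MvPolynomial.funext
  intro z
  have hGz : MvPolynomial.eval z G = MvPolynomial.eval (fun i => z i - c₀ i) Gt := by
    rw [hGt_eval]
    have e : (fun i => c₀ i + (z i - c₀ i)) = z := by funext i; ring
    rw [e]
  rw [hGz, hR, hRr, hL₁]
  simp
  rw [hγ1, hγ0']
  ring

end Geo

end Literature.RingTheory.MvPolynomial.PlaneCurves

end
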